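import Summits.BirchSwinnertonDyer.BirchSwinnertonDyer.Theorems.Rank2Observatory2DescClCurveCertSSound
import HarnessLib

/-!
# BirchSwinnertonDyer — rank ≥ 2 observatory: KERNEL-2DESC-CL v3.0, S4 — the SPLIT-2 per-curve certificate (complex case), part 3/4: the main theorem

HONEST FRAMING: per-curve certified theorems and census instruments; no claim on BSD in rank ≥ 2.

Part 3 of 4 (mechanism in part 1, `…ClCurveCertSDefs`).  This part: `log ord` of a family element at `W₁`, `W₂`
(read on `X`, `q ∤ m₁`), the code primes of the tagged support (`α`-codes and split primes), and the main theorems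
`rank_le_of_checkS` (the cover-set theorem `mordellWeilRank_le_of_coverSet_cl` applied to the genuine `𝓞 K`
elements) and `rank_eq_of_checkS`.  New declarations only.
Sorry-free; axioms `propext`, `Classical.choice`, `Quot.sound`.
[cite: Cassels1991LecturesEllipticCurves, §15] [cite: CremonaAlgorithms1997, §3.6] [cite: Cohen1993, §6.5]
-/

set_option linter.dupNamespace false

noncomputable section

open scoped Classical NumberField nonZeroDivisors

open Literature.NumberTheory.NumberFields Polynomial Module NumberField IsDedekindDomain Ideal

namespace Summit.BirchSwinnertonDyer.BirchSwinnertonDyer.Rank2Observatory.TwoDescCl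

open TwoDescCubic ClFieldCert

section Sound

variable {K : Type*} [Field K] [NumberField K] {θ : K} {F : ClFieldCertS2} {cc : ClCurveCertS} {f : FamEntryS}

/-! ### `log ord` at `W₁`, `W₂` -/

/-- The element `q` of the family is literally `q`. -/
theorem eltS_eq_q (hθ : aeval θ (MonicCubic.poly F.fs.base.a F.fs.base.b F.fs.base.c) = 0)
    (hK : F.checkConst = true) (h : famCheckS F cc f = true) (h1 : f.kind = 1) :
    (fracOf F f.X f.tsn).toInt hθ (frac_of_famCheckS h) = ((F.fs.base.q : ℕ) : 𝓞 K) := by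
  have hk := kind_of_famCheckS h
  unfold famKindCheckS at hk
  rw [if_pos h1, decide_eq_true_eq] at hk
  have hX : lin hθ f.X.1 f.X.2.1 f.X.2.2 = (F.m₁ : 𝓞 K) * ((F.fs.base.q : ℕ) : 𝓞 K) := by
    rw [hk]
    simp only
    rw [lin_const hθ]
    push_cast
    ring
  exact mul_left_cancel₀ (m₁S_ne_zero_O hK) ((m₁_mul_eltS hθ (frac_of_famCheckS h)).trans hX)

/-- `|N(q)| = q³ · 1`. -/
theorem natAbs_norm_qS (hθ : aeval θ (MonicCubic.poly F.fs.base.a F.fs.base.b F.fs.base.c) = 0)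
    (h3 : finrank ℚ K = 3) (hS : F.fs.checkCoreS = true) :
    (Algebra.norm ℤ ((F.fs.base.q : ℕ) : 𝓞 K)).natAbs = F.fs.base.q ^ 3 * 1 := by
  have e := natAbs_norm_lin_coords (F.fs.base.irreducible_of_reg (F.fs.checkReg_of_coreS hS)) hθ h3
    ((F.fs.base.q : ℤ), 0, 0)
  simp only at e
  rw [lin_q hθ] at e
  rw [e]
  simp [normFormZ, Int.natAbs_pow]

/-- **`log ord_{W₁}(x)`** of a family element (read on `X`; `q ∤ m₁`). [cite: Marcus2018, Ch. 3, Thm. 22] -/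
theorem log_W₁_of_famCheckS (hθ : aeval θ (MonicCubic.poly F.fs.base.a F.fs.base.b F.fs.base.c) = 0)
    (h3 : finrank ℚ K = 3) (hS : F.fs.checkCoreS = true) (hK : F.checkConst = true)
    (hpr : F.fs.base.primeList.Forall Nat.Prime) (h : famCheckS F cc f = true) :
    WithZero.log ((F.fs.base.W₁r hθ h3 (F.fs.checkReg_of_coreS hS) hpr).valuation K
      (((fracOf F f.X f.tsn).toInt hθ (frac_of_famCheckS h) : 𝓞 K) : K)) = famL₁S f := by
  have hR := F.fs.checkReg_of_coreS hS
  have hq := F.fs.base.q_prime hpr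
  unfold famL₁S
  by_cases h1 : f.kind = 1
  · rw [if_pos h1, eltS_eq_q hθ hK h h1]
    have hm : ¬ F.fs.base.q ∣ 1 := fun hd => hq.one_lt.ne' (Nat.dvd_one.mp hd)
    exact (log_valuation_eq_neg_one_of_one_two hq (W₁r_ne_W₂r hθ h3 hR hpr) (eq_W₁r_or_W₂r hθ h3 hR hpr)
      (absNorm_W₁r hθ h3 hR hpr) (absNorm_W₂r hθ h3 hR hpr) (q_mem_W₁r hθ h3 hR hpr)
      (q_mem_W₂r hθ h3 hR hpr) (natAbs_norm_qS hθ h3 hS) hm).1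
  rw [if_neg h1]
  have hk := kind_of_famCheckS h
  unfold famKindCheckS at hk
  rw [if_neg h1, Bool.and_eq_true] at hk
  obtain ⟨hinv, hord⟩ := hk
  have hdisp := valuation_eq_of_natCast_mul_eq (F.fs.base.W₁r hθ h3 hR hpr)
    (m₁_not_mem_of_q hK _ (q_mem_W₁r hθ h3 hR hpr)) (m₁_mul_eltS hθ (frac_of_famCheckS h))
  rw [hdisp]
  obtain ⟨hN, hm⟩ := natAbs_norm_of_ordCheck_reg hθ h3 hR hord
  refine log_valuation_eq_of_forall_not_mem hq
    ({F.fs.base.W₁r hθ h3 hR hpr, F.fs.base.W₂r hθ h3 hR hpr} : Finset _)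
    (fun u hu => by
      rcases eq_W₁r_or_W₂r hθ h3 hR hpr u hu with h | h <;> simp [h])
    (fun u => if u = F.fs.base.W₁r hθ h3 hR hpr then 1 else 2) (fun u hu => ?_) (by simp) (by simp) ?_ ?_ hm
  · simp only [Finset.mem_insert, Finset.mem_singleton] at hu
    rcases hu with rfl | rfl
    · simp [absNorm_W₁r]
    · rw [if_neg (W₁r_ne_W₂r hθ h3 hR hpr).symm]; exact absNorm_W₂r hθ h3 hR hpr
  · intro u hu hne
    simp only [Finset.mem_insert, Finset.mem_singleton] at hu
    rcases hu with rfl | rfl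
    · exact absurd rfl hne
    · exact lin_not_mem_of_invCert hθ _ (W₂r_asIdeal hθ h3 hR hpr) hinv
  · simpa using hN

/-- **`log ord_{W₂}(x)`** of a family element. [cite: Marcus2018, Ch. 3, Thm. 22] -/
theorem log_W₂_of_famCheckS (hθ : aeval θ (MonicCubic.poly F.fs.base.a F.fs.base.b F.fs.base.c) = 0)
    (h3 : finrank ℚ K = 3) (hS : F.fs.checkCoreS = true) (hK : F.checkConst = true)
    (hpr : F.fs.base.primeList.Forall Nat.Prime) (h : famCheckS F cc f = true) :
    WithZero.log ((F.fs.base.W₂r hθ h3 (F.fs.checkReg_of_coreS hS) hpr).valuation K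
      (((fracOf F f.X f.tsn).toInt hθ (frac_of_famCheckS h) : 𝓞 K) : K)) = famL₂S f := by
  have hR := F.fs.checkReg_of_coreS hS
  have hq := F.fs.base.q_prime hpr
  unfold famL₂S
  by_cases h1 : f.kind = 1
  · rw [if_pos h1, eltS_eq_q hθ hK h h1]
    have hm : ¬ F.fs.base.q ∣ 1 := fun hd => hq.one_lt.ne' (Nat.dvd_one.mp hd)
    exact (log_valuation_eq_neg_one_of_one_two hq (W₁r_ne_W₂r hθ h3 hR hpr) (eq_W₁r_or_W₂r hθ h3 hR hpr)
      (absNorm_W₁r hθ h3 hR hpr) (absNorm_W₂r hθ h3 hR hpr) (q_mem_W₁r hθ h3 hR hpr)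
      (q_mem_W₂r hθ h3 hR hpr) (natAbs_norm_qS hθ h3 hS) hm).2
  rw [if_neg h1]
  have hk := kind_of_famCheckS h
  unfold famKindCheckS at hk
  rw [if_neg h1, Bool.and_eq_true] at hk
  have hdisp := valuation_eq_of_natCast_mul_eq (F.fs.base.W₂r hθ h3 hR hpr)
    (m₁_not_mem_of_q hK _ (q_mem_W₂r hθ h3 hR hpr)) (m₁_mul_eltS hθ (frac_of_famCheckS h))
  rw [hdisp, valuation_eq_one_of_invCert hθ _ (W₂r_asIdeal hθ h3 hR hpr) hk.1, WithZero.log_one]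

/-! ### The code primes of the support -/

variable (F) in
/-- The height-one prime of a tagged support code: an `α`-code prime, or the split prime `w_i`, `i = code.1`. -/
def codePrimeS (hθ : aeval θ (MonicCubic.poly F.fs.base.a F.fs.base.b F.fs.base.c) = 0) (h3 : finrank ℚ K = 3)
    (hS : F.fs.checkCoreS = true) (hpr : F.fs.base.primeList.Forall Nat.Prime) (bc : (Bool × PCode) × FamEntryS) :
    HeightOneSpectrum (𝓞 K) :=
  if bc.1.1 = true then codePrimeR hθ h3 (F.fs.checkReg_of_coreS hS) hpr bc.1.2
  else if h : bc.1.2.1 < 3 then SplitTwo.w (F.fs.base.irreducible_of_reg (F.fs.checkReg_of_coreS hS)) hθ h3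
    (F.fs.splitCheck_of_coreS hS) ⟨bc.1.2.1, h⟩
  else F.fs.base.W₁r hθ h3 (F.fs.checkReg_of_coreS hS) hpr

/-! ### The main theorem -/

/-- **Soundness of the split-2 per-curve checker: `rank E(ℚ) ≤ r`.** [cite: Cassels1991LecturesEllipticCurves, §15] -/
theorem rank_le_of_checkS (r : ℕ) (F : ClFieldCertS2)
    (hθ : aeval θ (MonicCubic.poly F.fs.base.a F.fs.base.b F.fs.base.c) = 0) (h3 : finrank ℚ K = 3)
    (h2 : F.check2 = true) (hpr : F.fs.base.primeList.Forall Nat.Prime) (cc : ClCurveCertS)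
    (hc : checkS F cc r = true) : ((⟨0, cc.A, 0, cc.B, cc.C⟩ : WeierstrassCurve ℚ)).mordellWeilRank ≤ r := by
  classical
  have hK := F.const_of_check2 h2
  have hS := F.coreS_of_check2 h2
  have hfd := F.field_of_check2 h2
  have hR := F.fs.checkReg_of_coreS hS
  have hirr := F.fs.base.irreducible_of_reg hR
  have h0 := (F.fs.base.interval_of_field hfd).1
  have hq := F.fs.base.q_prime hpr
  simp only [checkS, Bool.and_eq_true, decide_eq_true_eq, List.all_eq_true] at hc
  obtain ⟨⟨⟨⟨⟨⟨⟨⟨⟨⟨⟨⟨⟨⟨⟨⟨⟨hΔ, hirrF⟩, hcub⟩, hder⟩, htX⟩, htD⟩, hdisc⟩, hND0⟩, hdn⟩, hdnC⟩, hcodes⟩, hdW1⟩,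
    hdW2⟩, hQ⟩, hhead⟩, hfamAll⟩, hcert⟩, hcount⟩ := hc
  haveI hEl := isElliptic_of_deltaShort_ne hΔ
  have hirrF' := irreducible_of_noRootMod hirrF
  have hm₁K : (F.m₁ : K) ≠ 0 := m₁S_ne_zero_K hK
  have hm₁O : (F.m₁ : 𝓞 K) ≠ 0 := m₁S_ne_zero_O hK
  -- `θ_E = e₀`, root of `F`
  set eT : 𝓞 K := (fracOf F cc.Xt cc.tsnT).toInt hθ htX with heT
  set eD : 𝓞 K := (fracOf F cc.XD cc.tsnD).toInt hθ htD with heD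
  have hXe := m₁_mul_eltS_coe hθ htX
  have haevX := aeval_lin_eq_zero_of_coords hθ cc.Xt hcub
  have haev : aeval (algebraMap (𝓞 K) K eT) (MonicCubic.poly cc.A cc.B cc.C) = 0 := by
    rw [← hXe] at haevX
    simp only [MonicCubic.poly, map_add, map_mul, map_pow, aeval_X, eq_intCast, map_intCast, map_natCast]
      at haevX ⊢
    have h3' : (F.m₁ : K) ^ 3 ≠ 0 := pow_ne_zero 3 hm₁K
    apply mul_right_injective₀ h3'
    simp only [mul_zero]
    linear_combination haevX
  -- `D₀ = F′(e₀)`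
  have hderX := deriv_eq_of_coords hθ cc.Xt (smulCoords (F.m₁ : ℤ) cc.XD) [] hder
  have hderiv : (3 : 𝓞 K) * eT ^ 2 + 2 * ((cc.A : ℤ) : 𝓞 K) * eT + ((cc.B : ℤ) : 𝓞 K) = eD := by
    rw [lin_smulCoords, ← m₁_mul_eltS hθ htX, ← m₁_mul_eltS hθ htD] at hderX
    simp only [List.map_nil, List.prod_nil, mul_one, Int.cast_mul, Int.cast_pow, Int.cast_natCast] at hderX
    have h2' : (F.m₁ : 𝓞 K) ^ 2 ≠ 0 := pow_ne_zero 2 hm₁O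
    apply mul_right_injective₀ h2'
    simp only
    linear_combination hderX
  have hD0 : eD ≠ 0 := eltS_ne_zero hθ h3 hS htD hND0
  have hq0 : ((F.fs.base.q : ℕ) : 𝓞 K) ≠ 0 := by exact_mod_cast hq.ne_zero
  have hM0 : eD * ((F.fs.base.q : ℕ) : 𝓞 K) ≠ 0 := mul_ne_zero hD0 hq0
  have hgen := closure_tsupp_eq_top_of_dvd
    (dvd_mul_left ((F.fs.base.q : ℕ) : 𝓞 K) eD) (F.fs.closure_q_eq_top_of_coreS hθ h3 hS hpr)
  have hDM : ∀ v : HeightOneSpectrum (𝓞 K), (3 : 𝓞 K) * eT ^ 2 + 2 * ((cc.A : ℤ) : 𝓞 K) * eT +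
      ((cc.B : ℤ) : 𝓞 K) ∈ v.asIdeal → eD * ((F.fs.base.q : ℕ) : 𝓞 K) ∈ v.asIdeal := by
    intro v hv
    rw [hderiv] at hv
    exact Ideal.mul_mem_right _ _ hv
  -- `D₀ ∉ W₁, W₂` (read on `X_D`)
  have hXD_W₁ : lin hθ cc.XD.1 cc.XD.2.1 cc.XD.2.2 ∉ (F.fs.base.W₁r hθ h3 hR hpr).asIdeal :=
    lin_not_mem_of_invCert hθ _ (W₁r_asIdeal hθ h3 hR hpr) hdW1
  have hXD_W₂ : lin hθ cc.XD.1 cc.XD.2.1 cc.XD.2.2 ∉ (F.fs.base.W₂r hθ h3 hR hpr).asIdeal :=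
    lin_not_mem_of_invCert hθ _ (W₂r_asIdeal hθ h3 hR hpr) hdW2
  have hDW₁ : eD ∉ (F.fs.base.W₁r hθ h3 hR hpr).asIdeal := fun h =>
    hXD_W₁ (by rw [← m₁_mul_eltS hθ htD]; exact Ideal.mul_mem_left _ _ h)
  have hDW₂ : eD ∉ (F.fs.base.W₂r hθ h3 hR hpr).asIdeal := fun h =>
    hXD_W₂ (by rw [← m₁_mul_eltS hθ htD]; exact Ideal.mul_mem_left _ _ h)
  -- the support `T = {W₁, W₂} ∪ code primes`
  set L := cc.codes.length with hL
  let Tf : Fin (L + 2) → HeightOneSpectrum (𝓞 K) := Matrix.vecCons (F.fs.base.W₁r hθ h3 hR hpr)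
    (Matrix.vecCons (F.fs.base.W₂r hθ h3 hR hpr) fun i => codePrimeS F hθ h3 hS hpr (cc.codes.get i))
  have hT : ∀ w : HeightOneSpectrum (𝓞 K), eD * ((F.fs.base.q : ℕ) : 𝓞 K) ∈ w.asIdeal → ∃ i, Tf i = w := by
    intro w hw
    have hqw : ((F.fs.base.q : ℕ) : 𝓞 K) ∈ w.asIdeal → ∃ i, Tf i = w := fun hqw => by
      rcases eq_W₁r_or_W₂r hθ h3 hR hpr w hqw with rfl | rfl
      · exact ⟨0, by simp [Tf]⟩
      · exact ⟨1, by simp [Tf]⟩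
    rcases w.isPrime.mem_or_mem hw with hD | hq'
    · have hXv : lin hθ cc.XD.1 cc.XD.2.1 cc.XD.2.2 ∈ w.asIdeal := by
        rw [← m₁_mul_eltS hθ htD]; exact Ideal.mul_mem_left _ _ hD
      obtain ⟨pe, hpe, hpv⟩ := exists_prime_of_memS hθ h3 hS hND0 hdn w hXv
      rcases dispatch_soundS (cc := cc) hθ h3 hS hK hpr htD (m₁_mul_eltS hθ htD) (hdnC pe hpe) w hpv hD with
        hq'' | ⟨C, hmem, hany, hC, hw', -⟩ | ⟨i, hmem, hw'⟩
      · exact hqw hq''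
      · obtain ⟨bc, hbc, hbc1⟩ := List.mem_map.mp hmem
        obtain ⟨i, hi⟩ := List.mem_iff_get.mp hbc
        refine ⟨i.succ.succ, HeightOneSpectrum.ext ?_⟩
        simp only [Tf, Matrix.cons_val_succ]
        rw [hi, codePrimeS, if_pos (by rw [hbc1]), show bc.1.2 = C by rw [hbc1],
          codePrimeR_asIdeal hθ h3 hR hpr hany hC, hw']
      · obtain ⟨bc, hbc, hbc1⟩ := List.mem_map.mp hmem
        obtain ⟨i₀, hi₀⟩ := List.mem_iff_get.mp hbc
        refine ⟨i₀.succ.succ, ?_⟩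
        simp only [Tf, Matrix.cons_val_succ]
        rw [hi₀, hw']
        have hb1 : bc.1.1 = false := by rw [hbc1]
        have hb2 : bc.1.2.1 = (i : ℕ) := by rw [hbc1]
        unfold codePrimeS
        rw [if_neg (by rw [hb1]; exact Bool.false_ne_true), dif_pos (by rw [hb2]; exact i.isLt)]
        congr 1
        exact Fin.ext hb2
    · exact hqw hq'
  -- the family
  set fm := famS cc with hfm
  have hfam : ∀ j : Fin fm.length, famCheckS F cc (fm.get j) = true := fun j => hfamAll _ (List.get_mem _ j)
  let W : Fin fm.length → 𝓞 K := fun j =>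
    (fracOf F (fm.get j).X (fm.get j).tsn).toInt hθ (frac_of_famCheckS (hfam j))
  have hW0 : ∀ j, W j ≠ 0 := fun j => eltS_ne_zero hθ h3 hS _ (normFormZ_ne_of_famCheckS (hfam j))
  have hWval : ∀ j (v : HeightOneSpectrum (𝓞 K)), eD * ((F.fs.base.q : ℕ) : 𝓞 K) ∉ v.asIdeal →
      v.valuation K (algebraMap (𝓞 K) K (W j)) = 1 :=
    fun j v hv => valuation_eq_one_of_support _ _ (supp_of_famCheckS hθ h3 hS hK hpr hcodes htD (hfam j)) v hv
  obtain ⟨ρ, hlo, hhi⟩ := F.fs.base.exists_rho_of_field hθ h3 hfd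
  -- independence modulo squares: the parity certificate (rows computed on `X = m₁ x`, `m₁` a square)
  have hind : ∀ S : Finset (Fin fm.length), IsSquare (∏ i ∈ S, algebraMap (𝓞 K) K (W i)) → S = ∅ := by
    intro S hSq
    refine indep_of_parity_certificate (fun i => algebraMap (𝓞 K) K (W i)) (bitS F cc) ?_ hcert S hSq
    intro k S' hS'
    have hS'' : IsSquare (∏ i ∈ S', W i) := isSquare_prod_of_isSquare_prod_coe _ hS'
    obtain ⟨k, hk⟩ := k
    rcases k with _ | _ | _ | k
    · have h := even_card_of_isSquare_real ρ (fun i => algebraMap (𝓞 K) K (W i))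
        (fun i => rho_ne_zero_of_famCheckS hθ ρ hlo hhi h0 (hfam i)) hS'
      convert h using 2
      refine Finset.filter_congr (fun i _ => ?_)
      exact sign_iff_of_famCheckS hθ ρ hlo hhi h0 hK (hfam i)
    · exact even_card_of_isSquare_valuation (F.fs.base.W₁r hθ h3 hR hpr) W hW0 _
        (fun i => by
          show ((!decide ((2 : ℤ) ∣ famL₁S (fm.get i))) = true ↔ _)
          rw [log_W₁_of_famCheckS hθ h3 hS hK hpr (hfam i)]; simp) hS'
    · exact even_card_of_isSquare_valuation (F.fs.base.W₂r hθ h3 hR hpr) W hW0 _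
        (fun i => by
          show ((!decide ((2 : ℤ) ∣ famL₂S (fm.get i))) = true ↔ _)
          rw [log_W₂_of_famCheckS hθ h3 hS hK hpr (hfam i)]; simp) hS'
    · have hk' : k < F.fs.base.chars.length := by omega
      have hch : F.fs.base.chars.getD k ((3 : ℕ), (0 : ℤ), (0 : ℤ)) ∈ F.fs.base.chars := by
        rw [List.getD_eq_getElem?_getD, List.getElem?_eq_getElem hk', Option.getD_some]
        exact List.getElem_mem hk'
      obtain ⟨h2', ψ, hψ⟩ := F.fs.base.exists_psi_of_reg hθ h3 hR hpr hch
      haveI : Fact (F.fs.base.chars.getD k (3, 0, 0)).1.Prime := ⟨F.fs.base.char_prime hpr hch⟩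
      have hSX : IsSquare (∏ i ∈ S', lin hθ (fm.get i).X.1 (fm.get i).X.2.1 (fm.get i).X.2.2) := by
        have e1 : ∀ i ∈ S', lin hθ (fm.get i).X.1 (fm.get i).X.2.1 (fm.get i).X.2.2 = (F.m₁ : 𝓞 K) * W i :=
          fun i _ => (m₁_mul_eltS hθ (frac_of_famCheckS (hfam i))).symm
        rw [Finset.prod_congr rfl e1, Finset.prod_mul_distrib, Finset.prod_const]
        obtain ⟨z, hz⟩ := hS''
        refine ⟨(F.r₁ : 𝓞 K) ^ S'.card * z, ?_⟩
        rw [hz]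
        simp only [ClFieldCertS2.m₁, Nat.cast_pow]
        ring
      have h := even_card_filter_eulerBit hθ (ℓ := (F.fs.base.chars.getD k (3, 0, 0)).1) (by omega) ψ hψ
        (fun i => (fm.get i).X) (fun i => not_dvd_evalInt_of_famCheckS (hfam i) hch) hSX
      convert h using 2
      exact Finset.filter_congr (fun i _ => Iff.rfl)
  -- spanning of the `T`-units modulo squares
  have hodd : Odd (finrank ℚ K) := by rw [h3]; decide
  have hn : fm.length = NumberField.Units.rank K + 1 + (L + 2) := by
    rw [F.fs.base.units_rank_of_field hθ h3 hfd]
    simp only [hfm, famS, List.length_append, List.length_map, hL, hhead]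
    omega
  have hspan : ∀ u : K, u ≠ 0 →
      (∀ v : HeightOneSpectrum (𝓞 K), eD * ((F.fs.base.q : ℕ) : 𝓞 K) ∉ v.asIdeal → v.valuation K u = 1) →
      ∃ U : Finset (Fin fm.length), IsSquare (u * ∏ j ∈ U, algebraMap (𝓞 K) K (W j)) :=
    fun u hu huT => exists_isSquare_tunit_mul_prod hodd _ Tf hT hn (fun j => algebraMap (𝓞 K) K (W j))
      (fun j => RingOfIntegers.coe_ne_zero_iff.mpr (hW0 j)) hWval hind u hu huT
  -- the sieve is sound at rational points
  have hθQ : ∀ x : ℚ, algebraMap ℚ K x ≠ algebraMap (𝓞 K) K eT :=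
    ne_of_powIndep (powIndep_algebraMap hirrF' haev h3)
  have hFrel : eT ^ 3 + cc.A * eT ^ 2 + cc.B * eT + cc.C = 0 := by
    apply RingOfIntegers.coe_injective
    simpa only [map_add, map_mul, map_pow, map_intCast, _root_.map_zero] using MonicCubic.theta_rel haev
  have hadm0 : admS F cc ∅ ∅ = true := by
    simp only [admS, Bool.and_eq_true, decide_eq_true_eq, Finset.filter_empty, Finset.card_empty]
    exact ⟨⟨admStdQ_empty _ hQ _ _ _ _, by decide⟩, by decide⟩
  have hadm : ∀ x y : ℚ, y ^ 2 = x ^ 3 + cc.A * x ^ 2 + cc.B * x + cc.C →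
      ∀ (T : Finset (Fin 0)) (U : Finset (Fin fm.length)),
        IsSquare ((algebraMap ℚ K x - algebraMap (𝓞 K) K eT) *
          (∏ i ∈ T, algebraMap (𝓞 K) K (((fun i : Fin 0 => i.elim0 : Fin 0 → (𝓞 K)ˣ) i : (𝓞 K)ˣ) : 𝓞 K)) *
            ∏ j ∈ U, algebraMap (𝓞 K) K (W j)) → admS F cc T U = true := by
    intro x y hxy T U hsq
    have hcof := cofactor_pos_of_disc_neg (rho_theta_root ρ haev) hdisc
    have h1 : admStd (fun i : Fin 0 => i.elim0) (famNormS F cc) (fun i : Fin 0 => i.elim0) (famSignS cc) T U =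
        true :=
      admStd_sound hirrF' haev h3 ρ hcof (w := fun i : Fin 0 => algebraMap (𝓞 K) K
          (((fun i : Fin 0 => i.elim0 : Fin 0 → (𝓞 K)ˣ) i : (𝓞 K)ˣ) : 𝓞 K))
        (g := fun j => algebraMap (𝓞 K) K (W j)) (fun i => i.elim0)
        (fun j => RingOfIntegers.coe_ne_zero_iff.mpr (hW0 j)) (fun i => i.elim0)
        (fun j => norm_eltS hθ h3 hS hK (frac_of_famCheckS (hfam j)) (dvd_of_famCheckS (hfam j)))
        (fun i => i.elim0)
        (fun j => sign_iff_of_famCheckS hθ ρ hlo hhi h0 hK (hfam j)) x y hxy T U hsq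
    have h2'' := valRow_sound hFrel hθQ (F.fs.base.W₁r hθ h3 hR hpr) (by rw [hderiv]; exact hDW₁) hW0
      (r := fun j => bitRowS F.fs.base (fm.get j) 1) (fun j => by
        show ((!decide ((2 : ℤ) ∣ famL₁S (fm.get j))) = true ↔ _)
        rw [show algebraMap (𝓞 K) K (W j) = ((W j : 𝓞 K) : K) from rfl,
          log_W₁_of_famCheckS hθ h3 hS hK hpr (hfam j)]; simp) x y hxy T U hsq
    have h3'' := valRow_sound hFrel hθQ (F.fs.base.W₂r hθ h3 hR hpr) (by rw [hderiv]; exact hDW₂) hW0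
      (r := fun j => bitRowS F.fs.base (fm.get j) 2) (fun j => by
        show ((!decide ((2 : ℤ) ∣ famL₂S (fm.get j))) = true ↔ _)
        rw [show algebraMap (𝓞 K) K (W j) = ((W j : 𝓞 K) : K) from rfl,
          log_W₂_of_famCheckS hθ h3 hS hK hpr (hfam j)]; simp) x y hxy T U hsq
    simp only [admS, Bool.and_eq_true]
    exact ⟨⟨admStdQ_of_admStd hQ h1, h2''⟩, h3''⟩
  exact mordellWeilRank_le_of_coverSet_cl (A := cc.A) (B := cc.B) (C := cc.C)
    (⟨0, cc.A, 0, cc.B, cc.C⟩ : WeierstrassCurve ℚ) rfl rfl rfl rfl rfl hirrF' haev h3 hM0 hgen hDM hW0 hspan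
    (Wu := fun i : Fin 0 => i.elim0) (adm := admS F cc) hadm0 hadm (s' := r) hcount

/-- **`rank E(ℚ) = r`** from the checked split-2 field record, a checked split-2 curve record and the tree's
lower bound. [cite: CremonaAlgorithms1997, §3.6] -/
theorem rank_eq_of_checkS (r : ℕ) (F : ClFieldCertS2)
    (hθ : aeval θ (MonicCubic.poly F.fs.base.a F.fs.base.b F.fs.base.c) = 0) (h3 : finrank ℚ K = 3)
    (h2 : F.check2 = true) (hpr : F.fs.base.primeList.Forall Nat.Prime) (cc : ClCurveCertS)
    (hc : checkS F cc r = true)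
    (hlow : r ≤ (((⟨0, cc.A, 0, cc.B, cc.C⟩ : WeierstrassCurve ℤ)).map (Int.castRingHom ℚ)).mordellWeilRank) :
    (((⟨0, cc.A, 0, cc.B, cc.C⟩ : WeierstrassCurve ℤ)).map (Int.castRingHom ℚ)).mordellWeilRank = r := by
  have hmap : ((⟨0, cc.A, 0, cc.B, cc.C⟩ : WeierstrassCurve ℤ)).map (Int.castRingHom ℚ) =
      (⟨0, cc.A, 0, cc.B, cc.C⟩ : WeierstrassCurve ℚ) := by
    ext <;> simp [WeierstrassCurve.map]
  rw [hmap] at hlow ⊢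
  exact le_antisymm (rank_le_of_checkS r F hθ h3 h2 hpr cc hc) hlow

end Sound

end Summit.BirchSwinnertonDyer.BirchSwinnertonDyer.Rank2Observatory.TwoDescCl

end
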